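import Literature.AlgebraicGeometry.Resolution.ExceptionalDivisorRegularGlobal
import Literature.AlgebraicGeometry.Resolution.PermissibleCentres
import Literature.AlgebraicGeometry.Resolution.RegularLocusOpen
import HarnessLib

/-!
# [OURS · L1 W4.5(b) · EL♮(3) · T23-A″-S, first brick `invS_base`] The REDUCED exceptional plane of the blow-up of a closed REGULAR POINT —
# Liu 8.1.19 (b) localised: only `𝒪_{F,x}` regular is assumed, not the ambient stage

Crux chain w45b, child EL♮(3) = stmt-ResolutionOfSingularities-20148; T23-A″-S = the SEED widening of the boundary-witnessed («pair») round
engine (res-L1-w45b-stub-4 g11 `T23Adprime-ENGINE-WORD.md` 16d03a46d50c8ccd §S; desk res-L1-w45b-plan-1 RULING R20 (ii), 2026-08-28T08:09:27Z: «lead-1 =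
LOCAL»): the point plane `St(E_x)` becomes a retained member only with an `O`-model whose TRACE IS REDUCED, and at the seed that trace is the exceptional
plane `υ⁻¹{x}` of the downstairs point step `υ : F′ → F`. The tree's `IsBlowup.comap_vanishingIdeal_eq_vanishingIdeal_preimage`
(ExceptionalDivisorRegularGlobal) gives `𝓘{x}·𝒪_{F′} = 𝓘⟨υ⁻¹{x}⟩` when the WHOLE stage `F` is regular — true at stage 1 (`F = P_k`), but the engine
does not track regularity of later downstairs stages. This file removes that hypothesis for a POINT centre: only `𝒪_{F,x}` regular is used (the
exceptional divisor lives over `Spec 𝒪_{F,x}`).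

* `exists_isQuasiRegular_away_of_isRegularLocalRing_atPrime` — ring step: the tree's local structure theorem
  `exists_isQuasiRegular_away_of_isRegularRing` (RegularCentreLocal; Liu 8.1.19 proof, EGA IV 16.9 / 17.12) re-proved from `A_𝔭` regular and `A ⧸ I`
  regular ONLY (no regularity of `A`; the conclusion «`A[1/g]` regular» — never consumed by the affine model case — is dropped): on a basic open
  `D(g) ∋ 𝔭` the ideal `I` is generated by a quasi-regular sequence with regular quotient;
* `isRegular_subscheme_comap_vanishingIdeal_singleton_of_isRegularLocalRing` — **the exceptional plane `E = V(𝓘{x}·𝒪_{F′})` of ANY blow-up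
  `υ` of a locally Noetherian `F` at a closed point `x` with `𝒪_{F,x}` regular is a REGULAR scheme** (the tree's `IsBlowup.isRegular_subscheme_comap`
  with its two global-regularity uses replaced at the closed point: `𝔪_x` is maximal, so `Γ(W) ⧸ 𝔪_x` is a field);
* `comap_vanishingIdeal_singleton_eq_of_isRegularLocalRing` — **hence `𝓘{x}·𝒪_{F′} = 𝓘⟨υ⁻¹{x}⟩`** (reduced), the letter of `invS_base`;
  `isRegular_subscheme_vanishingIdeal_preimage_singleton_of_isRegularLocalRing` — the reduced plane `V(𝓘⟨υ⁻¹{x}⟩)` is regular.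

Everything is proved; DEF-FREE; no `sorry`; standard axioms. OURS; NOT a statement of any manuscript; AI-written, weaker than expert review.
`--supports stmt-ResolutionOfSingularities-20148 --as helper`. [cite: Liu2002, Thm. 8.1.19 (b)] (method; index only).
-/

set_option linter.dupNamespace false -- mandated namespace `Summit.<Summit>.<Problem>` of this single-conjunct summit

noncomputable section

open CategoryTheory CategoryTheory.Limits AlgebraicGeometry TopologicalSpace IsLocalRing
open Literature.AlgebraicGeometry.Resolution
open AlgebraicGeometry.Scheme.IdealSheafData

namespace Summit.ResolutionOfSingularities.ResolutionOfSingularities.Cruxes.EquisingularLiftNat.Sections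

universe u

/-! ### The ring step at ONE prime -/

/-- **Local structure of a regular centre at a prime, from `A_𝔭` regular only** (adapted from the tree's
`exists_isQuasiRegular_away_of_isRegularRing`, RegularCentreLocal): `A` Noetherian, `I ⊆ 𝔭` with `A_𝔭` a regular local ring and `A ⧸ I` a
regular ring. Then there are `g ∉ 𝔭` and `f₁, …, f_c ∈ I` such that in `A[1/g]`: `I·A[1/g] = (f)`, `f` is quasi-regular, and `A[1/g] ⧸ I·A[1/g]`
is a regular ring. [cite: Liu2002, Thm. 8.1.19] -/
theorem exists_isQuasiRegular_away_of_isRegularLocalRing_atPrime {A : Type u} [CommRing A] [IsNoetherianRing A]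
    (I : Ideal A) [IsRegularRing (A ⧸ I)] (p : Ideal A) [hp : p.IsPrime] (hIp : I ≤ p)
    [IsRegularLocalRing (Localization.AtPrime p)] :
    ∃ g : A, g ∉ p ∧ ∃ (c : ℕ) (f : Fin c → A), (∀ i, f i ∈ I) ∧
      ∀ (L : Type u) [CommRing L] [Algebra A L] [IsLocalization.Away g L],
        Ideal.map (algebraMap A L) I = Ideal.span (Set.range (algebraMap A L ∘ f)) ∧
        IsQuasiRegular (algebraMap A L ∘ f) ∧
        IsRegularRing (L ⧸ Ideal.map (algebraMap A L) I) := by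
  -- adapted from Literature/AlgebraicGeometry/Resolution/RegularCentreLocal.lean (`exists_isQuasiRegular_away_of_isRegularRing`)
  classical
  have hJm : I.map (algebraMap A (Localization.AtPrime p)) ≤ maximalIdeal (Localization.AtPrime p) := by
    rw [← Localization.AtPrime.map_eq_maximalIdeal]
    exact Ideal.map_mono hIp
  haveI := isRegularLocalRing_localization_quotient_of_le I p hIp
  have hG : Ideal.span (algebraMap A (Localization.AtPrime p) '' (I : Set A)) =
      I.map (algebraMap A (Localization.AtPrime p)) := rfl
  obtain ⟨c, f', hf'G, hspan', -, hcolon'⟩ :=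
    exists_isQuasiRegular_span_eq_of_isRegularLocalRing_quotient hJm _ hG
  -- preimages `f_i ∈ I`
  have hpre : ∀ i, ∃ a : A, a ∈ I ∧ algebraMap A (Localization.AtPrime p) a = f' i := fun i => by
    obtain ⟨a, ha, h⟩ := hf'G i
    exact ⟨a, ha, h⟩
  choose f hfI hff' using hpre
  have hrange : Set.range f' = Set.range (algebraMap A (Localization.AtPrime p) ∘ f) := by
    ext z
    simp only [Set.mem_range, Function.comp_apply, hff']
  have himg : ∀ i : Fin c, Ideal.span (f' '' Set.Iio i) =
      (Ideal.span (f '' Set.Iio i)).map (algebraMap A (Localization.AtPrime p)) := fun i => by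
    rw [Ideal.map_span, Set.image_image]
    congr 1
    ext z
    simp only [Set.mem_image, hff']
  -- `f` is an `A_p`-sequence, in colon form over `A`
  have hreg : ∀ (i : Fin c) (y : A), f i * y ∈ Ideal.span (f '' Set.Iio i) →
      ∃ s : A, s ∉ p ∧ s * y ∈ Ideal.span (f '' Set.Iio i) := by
    intro i y hy
    have h1 : f' i * algebraMap A (Localization.AtPrime p) y ∈ Ideal.span (f' '' Set.Iio i) := by
      rw [himg, ← hff', ← map_mul]
      exact Ideal.mem_map_of_mem _ hy
    have h2 := hcolon' i (Set.Iio i) (fun h => lt_irrefl i h) _ h1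
    rw [himg, IsLocalization.algebraMap_mem_map_algebraMap_iff p.primeCompl] at h2
    obtain ⟨s, hs, hsy⟩ := h2
    exact ⟨s, hs, hsy⟩
  obtain ⟨g₁, hg₁p, hg₁⟩ := exists_uniform_multiplier_of_regular_at_prime f p hreg
  -- the generators of `I` lie in `(f) A_p`: clear denominators
  obtain ⟨gens, hgens⟩ := (IsNoetherian.noetherian I : I.FG)
  have hgen1 : ∀ x : A, x ∈ gens → ∃ t : A, t ∉ p ∧ t * x ∈ Ideal.span (Set.range f) := by
    intro x hx
    have hxI : x ∈ I := hgens ▸ Submodule.subset_span hx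
    have h1 : algebraMap A (Localization.AtPrime p) x ∈ Ideal.span (Set.range f') := by
      rw [hspan']
      exact Ideal.mem_map_of_mem _ hxI
    rw [hrange, Set.range_comp, ← Ideal.map_span,
      IsLocalization.algebraMap_mem_map_algebraMap_iff p.primeCompl] at h1
    obtain ⟨t, ht, htx⟩ := h1
    exact ⟨t, ht, htx⟩
  choose! t ht using hgen1
  have hg₀p : (∏ x ∈ gens, t x) ∉ p := by
    intro hmem
    obtain ⟨x, hx, htx⟩ := (hp.prod_mem_iff).mp hmem
    exact (ht x hx).1 htx
  refine ⟨(∏ x ∈ gens, t x) * g₁, fun h => (hp.mem_or_mem h).elim hg₀p hg₁p, c, f, hfI, ?_⟩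
  intro L _ _ _
  have hunit : ∀ x : A, x ∈ gens → IsUnit (algebraMap A L (t x)) := by
    intro x hx
    have hu : IsUnit (algebraMap A L ((∏ x ∈ gens, t x) * g₁)) :=
      IsLocalization.Away.algebraMap_isUnit _
    obtain ⟨r, hr⟩ : t x ∣ (∏ x ∈ gens, t x) * g₁ := (Finset.dvd_prod_of_mem t hx).mul_right g₁
    rw [hr, map_mul] at hu
    exact isUnit_of_mul_isUnit_left hu
  -- (a) `I A[1/g] = (f)`
  have hIL : I.map (algebraMap A L) = Ideal.span (Set.range (algebraMap A L ∘ f)) := by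
    apply le_antisymm
    · rw [← hgens, Ideal.map_span, Ideal.span_le]
      rintro _ ⟨x, hx, rfl⟩
      have hx' : x ∈ gens := hx
      have hmem : algebraMap A L (t x * x) ∈ Ideal.span (Set.range (algebraMap A L ∘ f)) := by
        rw [Set.range_comp, ← Ideal.map_span]
        exact Ideal.mem_map_of_mem _ (ht x hx').2
      rw [map_mul] at hmem
      exact (Ideal.unit_mul_mem_iff_mem _ (hunit x hx')).mp hmem
    · rw [Ideal.span_le]
      rintro _ ⟨i, rfl⟩
      exact Ideal.mem_map_of_mem _ (hfI i)
  -- (b) quasi-regular in `A[1/g]`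
  have hg : ∀ (i : Fin c) (y : A), f i * y ∈ Ideal.span (f '' Set.Iio i) →
      (∏ x ∈ gens, t x) * g₁ * y ∈ Ideal.span (f '' Set.Iio i) := fun i y hy => by
    rw [mul_assoc]
    exact Ideal.mul_mem_left _ _ (hg₁ i y hy)
  have hqr : IsQuasiRegular (algebraMap A L ∘ f) :=
    isQuasiRegular_of_regularSeq c _ fun i z hz => regularSeq_map_of_uniform_multiplier f hg L i z hz
  -- (c) regularity of `A[1/g] / I A[1/g]`, a localisation of `A/I`
  have hLq : IsRegularRing (L ⧸ I.map (algebraMap A L)) :=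
    isRegularRing_of_isLocalization
      (Algebra.algebraMapSubmonoid (A ⧸ I) (Submonoid.powers ((∏ x ∈ gens, t x) * g₁)))
      (L ⧸ I.map (algebraMap A L))
  exact ⟨hIL, hqr, hLq⟩

/-- The quotient of a ring by a maximal ideal is a regular ring (a field). [folklore] -/
theorem quotient_isMaximal_isRegularRing {A : Type u} [CommRing A] (m : Ideal A) [hm : m.IsMaximal] :
    IsRegularRing (A ⧸ m) := by
  letI : Field (A ⧸ m) := Ideal.Quotient.field m
  infer_instance

/-! ### The exceptional plane of the blow-up of a closed regular point -/

/-- **The exceptional plane of the blow-up of a closed REGULAR POINT is a regular scheme** (Liu 8.1.19 (b), localised): `F` locally Noetherian,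
`x ∈ F` a closed point with `𝒪_{F,x}` a regular local ring, `υ : F′ → F` ANY blow-up of the reduced point `𝓘{x}` (universal property `IsBlowup`);
then `E = V(𝓘{x}·𝒪_{F′})` is regular. No regularity of `F` away from `x` is assumed. [cite: Liu2002, Thm. 8.1.19 (b)] -/
theorem isRegular_subscheme_comap_vanishingIdeal_singleton_of_isRegularLocalRing {F F' : Scheme.{u}} [IsLocallyNoetherian F]
    {x : F} (hx : IsClosed ({x} : Set F)) (hreg : IsRegularLocalRing (F.presheaf.stalk x))
    {υ : F' ⟶ F} (hυ : IsBlowup υ (vanishingIdeal ⟨{x}, hx⟩)) :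
    Scheme.IsRegular ((vanishingIdeal ⟨{x}, hx⟩).comap υ).subscheme := by
  -- adapted from Literature/AlgebraicGeometry/Resolution/ExceptionalDivisorRegularGlobal.lean (`IsBlowup.isRegular_subscheme_comap`)
  set J : F.IdealSheafData := vanishingIdeal ⟨{x}, hx⟩ with hJ
  refine Scheme.IsRegular.of_forall_exists_isOpenImmersion fun p => ?_
  -- the point `x' ∈ F'` under `p ∈ E` lies over `x`
  set x' : F' := (J.comap υ).subschemeι p with hx'
  have hxs : υ x' ∈ J.support := by
    have h1 : x' ∈ Set.range ((J.comap υ).subschemeι) := ⟨p, rfl⟩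
    rw [Scheme.IdealSheafData.range_subschemeι, Scheme.IdealSheafData.support_comap] at h1
    exact h1
  have hυx : υ x' = x := by
    rw [← SetLike.mem_coe, hJ, coe_support_vanishingIdeal, Closeds.coe_mk] at hxs
    exact hxs
  -- an affine open `W ∋ x`; the prime `𝔭` of `x` is maximal and `Γ(W)_𝔭 ≅ 𝒪_{F,x}` is regular
  obtain ⟨W, hW, hxW, -⟩ := exists_isAffineOpen_mem_and_subset (X := F) (x := x) (U := ⊤) (Opens.mem_top _)
  haveI : IsNoetherianRing Γ(F, W) := IsLocallyNoetherian.component_noetherian ⟨W, hW⟩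
  set 𝔭 := hW.primeIdealOf ⟨x, hxW⟩ with h𝔭
  haveI h𝔭max : 𝔭.asIdeal.IsMaximal := by
    have hcl := hx.preimage hW.fromSpec.continuous
    rw [fromSpec_preimage_singleton hW hxW] at hcl
    exact (PrimeSpectrum.isClosed_singleton_iff_isMaximal _).mp hcl
  haveI h𝔭reg : IsRegularLocalRing (Localization.AtPrime 𝔭.asIdeal) := by
    have h := (mem_regularLocus_fromSpec_iff hW 𝔭).mp (by
      rw [Scheme.mem_regularLocus, h𝔭, hW.fromSpec_primeIdealOf ⟨x, hxW⟩]; exact hreg)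
    exact (mem_regularLocus 𝔭).mp h
  set I : Ideal Γ(F, W) := J.ideal ⟨W, hW⟩ with hI
  have hI𝔭 : I = 𝔭.asIdeal := by rw [hI, hJ, h𝔭]; exact vanishingIdeal_singleton_ideal hW hx hxW
  haveI : IsRegularRing (Γ(F, W) ⧸ I) := by rw [hI𝔭]; exact quotient_isMaximal_isRegularRing _
  -- membership in basic opens
  have hmemD : ∀ g : Γ(F, W), x ∈ F.basicOpen g ↔ g ∉ 𝔭.asIdeal := by
    intro g
    rw [← PrimeSpectrum.mem_basicOpen, ← hW.fromSpec_preimage_basicOpen g]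
    change _ ↔ hW.fromSpec 𝔭 ∈ F.basicOpen g
    rw [h𝔭, hW.fromSpec_primeIdealOf ⟨x, hxW⟩]
  -- the local structure theorem at `𝔭`: a basic open `D(g) ∋ x` where `𝓘{x}` is cut out by a quasi-regular sequence with regular quotient
  obtain ⟨g, hgp, c, f, -, hloc⟩ := exists_isQuasiRegular_away_of_isRegularLocalRing_atPrime I 𝔭.asIdeal hI𝔭.le
  have hxg : x ∈ F.basicOpen g := (hmemD g).mpr hgp
  set V : F.Opens := F.basicOpen g with hV
  have hVaff : IsAffineOpen V := hW.basicOpen g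
  haveI : IsAffine (V : Scheme.{u}) := hVaff
  -- `Γ(V, ⊤)` as a `Γ(F, W)`-algebra: a localisation away from `g`
  have hle : V.ι ''ᵁ ⊤ ≤ W := by rw [Scheme.Opens.ι_image_top]; exact F.basicOpen_le g
  letI alg : Algebra Γ(F, W) Γ((V : Scheme.{u}), ⊤) := (F.presheaf.map (homOfLE hle).op).hom.toAlgebra
  haveI hlocV : IsLocalization.Away g Γ((V : Scheme.{u}), ⊤) := by
    haveI := hW.isLocalization_basicOpen g
    refine IsLocalization.isLocalization_of_algEquiv (Submonoid.powers g)
      (AlgEquiv.ofRingEquiv (f := V.topIso.symm.commRingCatIsoToRingEquiv) fun a => ?_)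
    have hcomp : F.presheaf.map (homOfLE (F.basicOpen_le g)).op ≫ V.topIso.inv = F.presheaf.map (homOfLE hle).op := by
      rw [Scheme.Opens.topIso_inv]
      exact ((F.presheaf.map_comp _ _).symm.trans (by rfl))
    exact congrArg (fun φ : Γ(F, W) ⟶ Γ((V : Scheme.{u}), ⊤) => φ.hom a) hcomp
  obtain ⟨hIL, hqr, hLq⟩ := hloc Γ((V : Scheme.{u}), ⊤)
  -- the ideal of `J|_V` on the affine scheme `V`
  have hJV : (J.comap V.ι).ideal ⟨⊤, isAffineOpen_top _⟩ =
      Ideal.span (Set.range (algebraMap Γ(F, W) Γ((V : Scheme.{u}), ⊤) ∘ f)) := by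
    rw [← hIL, Scheme.IdealSheafData.ideal_comap_of_isOpenImmersion, Scheme.Opens.ι_appIso, Iso.refl_inv]
    have hWV : J.ideal ⟨V.ι ''ᵁ ⊤, (isAffineOpen_top (V : Scheme.{u})).image_of_isOpenImmersion V.ι⟩ =
        I.map (F.presheaf.map (homOfLE hle).op).hom :=
      (J.map_ideal (U := ⟨V.ι ''ᵁ ⊤, _⟩) (V := ⟨W, hW⟩) hle).symm
    rw [hWV]
    change (I.map _).comap (RingHom.id _) = _
    rw [Ideal.comap_id]
    rfl
  haveI : IsRegularRing (Γ((V : Scheme.{u}), ⊤) ⧸ Ideal.span (Set.range (algebraMap Γ(F, W) Γ((V : Scheme.{u}), ⊤) ∘ f))) := by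
    rw [← hIL]; exact hLq
  -- the exceptional subscheme of the blow-up restricted over `V` is regular …
  have hregV : Scheme.IsRegular ((J.comap V.ι).comap (υ ∣_ V)).subscheme :=
    IsBlowup.isRegular_subscheme_comap_of_isAffine_of_isQuasiRegular (J.comap V.ι) _ hJV hqr (hυ.restrict V)
  -- … and it is the open piece of `E` over `V`
  have hKV : (J.comap V.ι).comap (υ ∣_ V) = (J.comap υ).comap (υ ⁻¹ᵁ V).ι := by
    rw [← Scheme.IdealSheafData.comap_comp, ← Scheme.IdealSheafData.comap_comp, morphismRestrict_ι]
  rw [hKV] at hregV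
  refine ⟨_, ((J.comap υ).comapIso (υ ⁻¹ᵁ V).ι).hom ≫ pullback.snd (υ ⁻¹ᵁ V).ι (J.comap υ).subschemeι,
    inferInstance, ?_, hregV⟩
  -- `p` lies in that open piece since `υ x' = x ∈ V`
  have hp : p ∈ Set.range (pullback.snd (υ ⁻¹ᵁ V).ι (J.comap υ).subschemeι) := by
    rw [Scheme.Pullback.range_snd, Set.mem_preimage, Scheme.Opens.range_ι]
    change υ x' ∈ (V : Set F)
    rw [hυx]
    exact hxg
  obtain ⟨q, hq⟩ := hp
  refine ⟨((J.comap υ).comapIso (υ ⁻¹ᵁ V).ι).inv q, ?_⟩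
  have hq' : ((J.comap υ).comapIso (υ ⁻¹ᵁ V).ι).hom (((J.comap υ).comapIso (υ ⁻¹ᵁ V).ι).inv q) = q := by
    rw [← Scheme.Hom.comp_apply, Iso.inv_hom_id]
    rfl
  rw [Scheme.Hom.comp_apply, hq']
  exact hq

/-- Hence the exceptional plane `E = V(𝓘{x}·𝒪_{F′})` is reduced. [cite: Liu2002, Thm. 8.1.19 (b)] -/
theorem isReduced_subscheme_comap_vanishingIdeal_singleton_of_isRegularLocalRing {F F' : Scheme.{u}} [IsLocallyNoetherian F]
    {x : F} (hx : IsClosed ({x} : Set F)) (hreg : IsRegularLocalRing (F.presheaf.stalk x))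
    {υ : F' ⟶ F} (hυ : IsBlowup υ (vanishingIdeal ⟨{x}, hx⟩)) :
    IsReduced ((vanishingIdeal ⟨{x}, hx⟩).comap υ).subscheme :=
  (isRegular_subscheme_comap_vanishingIdeal_singleton_of_isRegularLocalRing hx hreg hυ).isReduced

/-- **`invS_base`: `𝓘{x}·𝒪_{F′} = 𝓘⟨υ⁻¹{x}⟩` — the exceptional plane of the blow-up of a closed regular point, with its inverse-image ideal,
IS the reduced closed subscheme on `υ⁻¹{x}`.** `F` locally Noetherian, `x` closed with `𝒪_{F,x}` regular, `υ` any blow-up of `𝓘{x}`.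
[cite: Liu2002, Thm. 8.1.19 (b)] -/
theorem comap_vanishingIdeal_singleton_eq_of_isRegularLocalRing {F F' : Scheme.{u}} [IsLocallyNoetherian F]
    {x : F} (hx : IsClosed ({x} : Set F)) (hreg : IsRegularLocalRing (F.presheaf.stalk x))
    {υ : F' ⟶ F} (hυ : IsBlowup υ (vanishingIdeal ⟨{x}, hx⟩)) :
    (vanishingIdeal ⟨{x}, hx⟩).comap υ = vanishingIdeal ⟨υ ⁻¹' {x}, hx.preimage υ.continuous⟩ := by
  haveI := isReduced_subscheme_comap_vanishingIdeal_singleton_of_isRegularLocalRing hx hreg hυ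
  have h := vanishingIdeal_preimage_eq_radical_comap υ hx
  change vanishingIdeal _ = ((vanishingIdeal ⟨{x}, hx⟩).comap υ).radical at h
  rw [radical_eq_of_isReduced_subscheme ((vanishingIdeal ⟨{x}, hx⟩).comap υ)] at h
  exact h.symm

/-- **The reduced exceptional plane `υ⁻¹{x}` is a REGULAR closed subscheme** (same hypotheses): the consumer-side reading of the two theorems
above (`Scheme.IsRegular (vanishingIdeal ⟨υ⁻¹{x}, _⟩).subscheme`). [cite: Liu2002, Thm. 8.1.19 (b)] -/
theorem isRegular_subscheme_vanishingIdeal_preimage_singleton_of_isRegularLocalRing {F F' : Scheme.{u}} [IsLocallyNoetherian F]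
    {x : F} (hx : IsClosed ({x} : Set F)) (hreg : IsRegularLocalRing (F.presheaf.stalk x))
    {υ : F' ⟶ F} (hυ : IsBlowup υ (vanishingIdeal ⟨{x}, hx⟩)) :
    Scheme.IsRegular (vanishingIdeal ⟨υ ⁻¹' {x}, hx.preimage υ.continuous⟩).subscheme := by
  rw [← comap_vanishingIdeal_singleton_eq_of_isRegularLocalRing hx hreg hυ]
  exact isRegular_subscheme_comap_vanishingIdeal_singleton_of_isRegularLocalRing hx hreg hυ

end Summit.ResolutionOfSingularities.ResolutionOfSingularities.Cruxes.EquisingularLiftNat.Sections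

end
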